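import Summits.Ventures.PercRepro.RankLevelSetLevelSixHeavyCellSq27DI2VX6
import Summits.Ventures.PercRepro.RankLevelSetTriangleUnionConfined
import Summits.Ventures.PercRepro.RankLevelSetLevelSixT22Free10Le14
import Summits.Ventures.PercRepro.RankLevelSetLevelSixArithConf_conf16_sq22F10
import Summits.Ventures.PercRepro.RankLevelSetLevelSixT22Cell10Partial

/-!
# PercRepro — THE CORE CELL `(22, 10)` MODULO ITS `k = 7` ROW: THE COLOOP-FREE CELL BY FORM (ii) (p8 g13, S3)

The coloop-free cell `(22, 10)` splits on `s₃ = #{triangles}` (the cap `16` = THE TRIANGLE DROP at `20 < 22`): `s₃ ≤ 14` on the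
existing cell `sq27di2v` (`c025_core_six_t22_free10_le14`, ratio `0.994`); `15 ≤ s₃ ≤ 16` by form (ii): `ν(S₃) ≥ 9` (p3's table:
`cq3 8 = 13 < 15`), the grid numeral `confined_bound_32_10_9 = 699660`, the x6 cell (ratio `0.982`). With the device
(`c025_core_six_twentytwo_ten_of_free_seven`) this gives `c025_core_six_twentytwo_ten_of_seven (h7) : RLS M 22 6` — the cell
`(22, 10)` modulo its `k = 7` row (the coloop-free count at rank `15`). Axioms: standard.
-/

open scoped Matroid

namespace PercRepro

namespace ThmN

open Set

variable {α : Type}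

/-- The confinement count at `n = 32`, `d = 10`, `ν ≥ 9`, `σ ≤ 3ν`: at most `699660`. -/
theorem confined_bound_32_10_9 (ν σ : ℕ) (hν0 : 9 ≤ ν) (hν10 : ν ≤ 10) (hσ : σ ≤ 3 * ν) (hσn : σ ≤ 32) :
    ∑ b ∈ Finset.range (10 - ν + 1), (32 - σ).choose b * σ.choose (6 - b) ≤ 699660 := by
  interval_cases ν <;> interval_cases σ <;> norm_num [Finset.sum_range_succ, Nat.choose]

/-- `cq3 ν < 15` below `ν = 9`. -/
theorem cq3_lt_fifteen_of_lt_nine (ν : ℕ) (h : ν < 9) : TriangleCap.cq3 ν < 15 := by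
  interval_cases ν <;> decide

set_option maxHeartbeats 1600000 in
/-- **The coloop-free cell `(22, 10)`, the branch `15 ≤ s₃ ≤ 16`** (form (ii), `ν(S₃) ≥ 9`, `X6 = 699660`). -/
theorem c025_core_six_t22_free10_conf16 (M : Matroid α) [M.Finite] (hcf : ∀ e ∈ M.E, ¬ M.IsColoop e)
    (hR : M.eRank = (22 : ℕ∞)) (hn : M.E.ncard = 22 + 10)
    (hfree : ∀ e ∈ M.E, ∃ A ⊆ M.E \ {e}, e ∉ M.closure A ∧ e ∉ M.closure ((M.E \ {e}) \ A))
    (hs3 : {C : Set α | M.IsCircuit C ∧ C.ncard = 3}.ncard ≤ 16)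
    (hlo : 15 ≤ {C : Set α | M.IsCircuit C ∧ C.ncard = 3}.ncard) :
    RLS M 22 6 := by
  have hR' : M.eRank = ((22 : ℕ) : ℕ∞) := hR
  classical
  have hd : M.E.encard = M.eRank + (10 : ℕ) := by
    rw [hR, ← M.ground_finite.cast_ncard_eq, hn]
    push_cast
    ring
  have hL : ∀ e ∈ M.E, ¬ M.IsLoop e := not_isLoop_of_free M hfree
  have hs : ∀ e ∈ M.E, ∀ f ∈ M.E, e ≠ f → M.eRk {e, f} = 2 := by
    intro e he f hf hef
    have h2 : (2 : ℕ∞) ≤ M.eRk {e, f} :=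
      two_le_eRk_of_two_le_ncard_of_free M hfree (pair_subset he hf) (by rw [ncard_pair hef])
    have h3 : M.eRk {e, f} ≤ 2 := by
      have := M.eRk_le_encard {e, f}
      rwa [encard_pair hef] at this
    exact le_antisymm h3 h2
  have hc : ∀ X ⊆ M.E, M.eRk X ≤ ((6 - 2 : ℕ) : ℕ∞) → (X.ncard : ℕ∞) ≤ M.eRk X + cnull 4 :=
    fun X hX hr => nullity_cap_core M hfree 4 (le_refl 4) X hX (by simpa using hr)
  have hc6 : cnull 4 + 1 ≤ 7 := by simp [cnull]
  have hcj : ∀ X ⊆ M.E, M.eRk X ≤ ((6 - 2 - 1 : ℕ) : ℕ∞) → (X.ncard : ℕ∞) ≤ M.eRk X + cnull (3) :=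
    fun X hX hr => nullity_cap_core M hfree 3 (by omega) X hX
      (by rwa [show (6 - 2 - 1 : ℕ) = 3 by omega] at hr)
  have hcj' : ∀ X ⊆ M.E, M.eRk X ≤ ((6 - 1 - 1 - 1 : ℕ) : ℕ∞) → (X.ncard : ℕ∞) ≤ M.eRk X + cnull (3) :=
    fun X hX hr => nullity_cap_core M hfree 3 (by omega) X hX
      (by rwa [show (6 - 1 - 1 - 1 : ℕ) = 3 by omega] at hr)
  have hUG : (Matroid.UG M 6 7).ncard ≤ 19 := by
    have := Matroid.ncard_UG_le_cf (M := M) (q := 6) (ν₁ := 7) (j := 2) (by norm_num) hcf hR' hn (by omega) hc hc6 hcj (by norm_num [cnull])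
    simpa using this
  have hUH : (Matroid.UH M 6 7).ncard ≤ 16 := by
    have := Matroid.ncard_UH_le_cf (M := M) (q := 6) (ν₁ := 7) (j' := 1) (by norm_num) hcf hR' hn (by omega) hc hc6 hcj' (by norm_num [cnull])
    simpa using this
  have hΦ : phiK 22 6 ≤ (2 : ℚ) ^ (22 + 6) / (((22 + 6).choose 6 : ℕ) : ℚ) := phiK_le_two_pow_div_six 22
  obtain ⟨ν, σ, hνd, hσ, hσn, hcq, hcount⟩ := exists_triangle_union_bound M hfree hR' hn
  have hν0 : 9 ≤ ν := by
    by_contra hlt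
    have := cq3_lt_fifteen_of_lt_nine ν (by omega)
    omega
  have hX := confined_bound_32_10_9 ν σ hν0 (by omega) hσ (by omega)
  have hX' : ∑ b ∈ Finset.range (10 - ν + 1), (22 + 10 - σ).choose b * σ.choose (6 - b) ≤ 699660 := by
    rw [show (22 : ℕ) + 10 = 32 by norm_num]; exact hX
  have h6 : {B : Set α | B ⊆ M.E ∧ B.ncard = 6 ∧ M.eRk B = 6 ∧ M.eRk (M.E \ B) = M.eRank}.ncard ≤ 699660 := by
    have hsub : {B : Set α | B ⊆ M.E ∧ B.ncard = 6 ∧ M.eRk B = 6 ∧ M.eRk (M.E \ B) = M.eRank} ⊆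
        {B : Set α | B ⊆ M.E ∧ B.ncard = 6 ∧ M.eRk (M.E \ B) = ((22 : ℕ) : ℕ∞)} := by
      rintro B ⟨hBE, hB6, _, hBs⟩
      exact ⟨hBE, hB6, by rw [← hR']; exact hBs⟩
    have hle := Set.ncard_le_ncard hsub (M.ground_finite.finite_subsets.subset (fun B hB => hB.1))
    exact hle.trans (hcount.trans hX')
  rw [RLS_iff]
  exact c025_core_six_heavy_cell_sq27di2v_x6 M 22 10 7 19 16 0 10000 316 16 1078 124 16 3696 8236
      ((22 + 6).choose 6) (Nat.choose_pos (by omega)) (phiK 22 6) hΦ (by norm_num) (by omega)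
      (by norm_num) hUG hUH (by omega) (Or.inl (by norm_num)) (by norm_num) (by norm_num) (by norm_num)
      hs3
      ((S1.ncard_fourCircuits_le_gb14 10 M hfree hd 32 (by rw [coloops_eq_empty_of_forall M hcf, Set.sdiff_empty, hn])).trans (by decide))
      (s5_cf_of M hfree hcf (d := 9) (by rw [hd]; norm_num) 32 910 1078 (by norm_num) (by omega) (by decide) (by omega))
      (s6_cf_of M hfree hcf (d := 9) (by rw [hd]; norm_num) 32 3003 3696 (by norm_num) (by omega) (by decide) (by omega))
      (s7_cf_of M hfree hcf (d := 9) (by rw [hd]; norm_num) 32 6435 8236 (by norm_num) (by omega) (by decide) (by omega))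
      (Or.inl tail_six_conf16_sq22F10) hR' hn hfree 699660 h6 level_six_poly_conf16_sq22F10

/-- **The coloop-free cell `(22, 10)`** (the split on `#{triangles}`; the cap `16` by THE TRIANGLE DROP). -/
theorem c025_core_six_t22_free10 (M : Matroid α) [M.Finite] (hcf : ∀ e ∈ M.E, ¬ M.IsColoop e)
    (hR : M.eRank = (22 : ℕ∞)) (hn : M.E.ncard = 22 + 10)
    (hfree : ∀ e ∈ M.E, ∃ A ⊆ M.E \ {e}, e ∉ M.closure A ∧ e ∉ M.closure ((M.E \ {e}) \ A)) : RLS M 22 6 := by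
  have hR' : M.eRank = ((22 : ℕ) : ℕ∞) := hR
  have hcap : {C : Set α | M.IsCircuit C ∧ C.ncard = 3}.ncard ≤ 16 :=
    (ncard_triangles_le_cq3_pred_of_coloopFree M hfree hcf hR' hn (by omega) (by omega) (by omega)).trans (by decide)
  by_cases h14 : {C : Set α | M.IsCircuit C ∧ C.ncard = 3}.ncard ≤ 14
  · exact c025_core_six_t22_free10_le14 M 22 le_rfl hcf h14 hR' hn hfree
  · exact c025_core_six_t22_free10_conf16 M hcf hR hn hfree hcap (by omega)

/-- **THE CORE CELL `(22, 10)` MODULO ITS `k = 7` ROW** (`h7` = the device's inequality for the coloop-free part of rank `15`). -/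
theorem c025_core_six_twentytwo_ten_of_seven (M : Matroid α) [M.Finite]
    (hR : M.eRank = (22 : ℕ∞)) (hn : M.E.ncard = 22 + 10)
    (hfree : ∀ e ∈ M.E, ∃ A ⊆ M.E \ {e}, e ∉ M.closure A ∧ e ∉ M.closure ((M.E \ {e}) \ A))
    (h7 : ∀ N : Matroid α, ∀ [N.Finite], (∀ e ∈ N.E, ¬ N.IsColoop e) → N.eRank = (15 : ℕ∞) → N.E.ncard = 15 + 10 →
      (∀ e ∈ N.E, ∃ A ⊆ N.E \ {e}, e ∉ N.closure A ∧ e ∉ N.closure ((N.E \ {e}) \ A)) →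
      phiK 22 6 * (Matroid.topCount N 15 6 : ℚ) ≤
        ∑ i ∈ Finset.range (7 + 1), ((Nat.choose 7 i : ℕ) : ℚ) * (Matroid.midShift N i 22 6 : ℚ)) :
    RLS M 22 6 :=
  c025_core_six_twentytwo_ten_of_free_seven M hR hn hfree
    (fun N _ hcf hRN hnN hfreeN => c025_core_six_t22_free10 N hcf hRN hnN hfreeN) h7

end ThmN

end PercRepro
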